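import Mathlib
import HarnessLib
import Summits.PneNP.PneNP.Theorems.CnfIdealGenLengthRankDefectRepresentationsExactification
import Summits.PneNP.PneNP.Theorems.CnfIdealGenLengthRankDefectRepresentationsSortingLemma
import Summits.PneNP.PneNP.Theorems.CnfIdealGenLengthRankDefectRepresentationsMergeLowerBound

/-!
# Crux `RankDefectRepresentations` (stmt-PneNP-18923), line `cell-union-merge`: stub T1 `stub_tableOfGenerator`

Registered worker stub `stub_tableOfGenerator` of the skeleton
`Cruxes/RankDefectRepresentations/Lines/cell_union_merge.lean` (brief §B2), kernel-checked exactly as registered: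

  GENERATOR-form polynomial rank-stability of idempotents (`PolyStableIdem`: `n` exact idempotents with pairwise
  commutator ranks `≤ t` are, eventually in `n` and uniformly in the characteristic-0 field, the dimension and `t`,
  within rank `n^a · t` of COMMUTING idempotents)
  ⟹ the TABLE form N0b (`UniformStability`: every `ρ : 2^{[n]} → K^{d×d}` with `ρ ∅ = 1` whose multiplication
  table for `(2^{[n]}, △)` holds up to rank `δ` is within rank `n^{a'} · δ` of a genuine representation `π`).

Route (memo §3.T1 of the line; the bookkeeping of `polyStable_of_uniformStability` (p607059) run backwards):
from the table `ρ` take the letters `U_i := ρ {i}` (almost involutions, almost commuting: defects `≤ δ`, `≤ 2δ`),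
the almost idempotents `M_i := (1 - U_i)/2`, exactify them (`exists_idempotent_near`: idempotents `E_i` with
`rank (M_i - E_i) ≤ δ`, commutators `≤ 6δ`), apply the hypothesis at `t := 6δ` (commuting idempotents `E'_i`,
`rank (E_i - E'_i) ≤ n^a · 6δ`), return to the commuting involutions `U'_i := 1 - 2 E'_i` and let `π S` be the
sorted product of the `U'_i`, `i ∈ S`: `π ∅ = 1`, `π S π T = π (S △ T)` (the sorting lemma `stub_sortingLemma`
at `t = 0`), and, peeling the letters of `S` in increasing order,
`rank (ρ S - π S) ≤ |S| · (δ + rank (U_i - U'_i)) ≤ n · (2δ + 6 n^a δ) ≤ n^{a+2} · δ` for `n ≥ 8`.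
Output exponent `a + 2`.

HONEST FRAMING: an elementary transfer between two currencies of the same negative rung (N0b); closing N0b would
REFUTE the crux; nothing here bears on P ≠ NP; F-N2 is a FRONTIER formal rung.
-/

set_option linter.dupNamespace false -- `Summit.PneNP.PneNP.…`: summit = sub-problem name (D-0017)

namespace Summit.PneNP.PneNP.Theorems.CnfIdealGenLengthRankDefectRepresentationsTableOfGenerator

open Filter
open Summit.PneNP.PneNP.Theorems.CnfIdealGenLength (exists_idempotent_near rank_neg_eq)
open Summit.PneNP.PneNP.Theorems.CnfIdealGenLengthRankDefectRepresentationsSortingLemma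
  (stub_sortingLemma lprod_cons_of_mem lprod_cons_of_not_mem)
open Summit.PneNP.PneNP.Theorems.CnfIdealGenLengthRankDefectRepresentationsMergeLowerBound (rank_sub_le')
open Literature.Computability.AlgebraicComplexity (rank_add_le rank_smul_le)

section Tools

variable {K : Type} [Field K] {n d : ℕ}

/-- A square matrix of rank `0` over a field is `0`. [folklore] -/
theorem eq_zero_of_rank_eq_zero {A : Matrix (Fin d) (Fin d) K} (h : A.rank = 0) : A = 0 := by
  classical
  rw [Matrix.rank, Submodule.finrank_eq_zero, LinearMap.range_eq_bot] at h
  ext i j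
  have := congr_fun (LinearMap.congr_fun h (Pi.single j 1)) i
  simpa using this

omit [Field K] in
/-- `{a} △ (S.erase a) = S` for `a ∈ S`. -/
theorem symmDiff_singleton_erase {S : Finset (Fin n)} {a : Fin n} (ha : a ∈ S) :
    symmDiff ({a} : Finset (Fin n)) (S.erase a) = S := by
  ext x
  rw [Finset.mem_symmDiff, Finset.mem_singleton, Finset.mem_erase]
  by_cases hx : x = a
  · subst hx
    simp [ha]
  · constructor
    · rintro (⟨h, _⟩ | ⟨⟨_, h⟩, _⟩)
      · exact absurd h hx
      · exact h
    · intro h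
      exact Or.inr ⟨⟨hx, h⟩, hx⟩

/-- **Peeling bookkeeping along a duplicate-free list.** If `ρ ∅ = 1`, peeling any letter `a ∈ S` off the
table costs rank `≤ δ` (`rank (ρ S - ρ {a} ρ (S ∖ a)) ≤ δ`) and every letter `ρ {a}` is within rank `c` of
`V a`, then `ρ S` is within rank `#{a ∈ l : a ∈ S} · (δ + c)` of the ordered product of the `V a`, `a ∈ S`,
along any duplicate-free list `l ⊇ S`. [folklore] -/
theorem rank_table_sub_lprod_le (ρ : Finset (Fin n) → Matrix (Fin d) (Fin d) K)
    (V : Fin n → Matrix (Fin d) (Fin d) K) {δ c : ℕ} (hρ0 : ρ ∅ = 1)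
    (hρ : ∀ (a : Fin n) (S : Finset (Fin n)), a ∈ S → (ρ S - ρ {a} * ρ (S.erase a)).rank ≤ δ)
    (hV : ∀ a, (ρ {a} - V a).rank ≤ c) :
    ∀ l : List (Fin n), l.Nodup → ∀ S : Finset (Fin n), (∀ x ∈ S, x ∈ l) →
      (ρ S - ((l.filter (· ∈ S)).map V).prod).rank ≤ (l.filter (· ∈ S)).length * (δ + c)
  | [], _, S, hS => by
      have hS0 : S = ∅ := Finset.eq_empty_of_forall_notMem fun x hx => by simpa using hS x hx
      subst hS0
      simp [hρ0]
  | a :: l, hnd, S, hS => by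
      have hal : a ∉ l := (List.nodup_cons.mp hnd).1
      have hl : l.Nodup := (List.nodup_cons.mp hnd).2
      by_cases haS : a ∈ S
      · -- peel the head letter `a`
        have hS' : ∀ x ∈ S.erase a, x ∈ l := by
          intro x hx
          rw [Finset.mem_erase] at hx
          rcases List.mem_cons.mp (hS x hx.2) with h | h
          · exact absurd h hx.1
          · exact h
        have hfilt : l.filter (· ∈ S) = l.filter (· ∈ S.erase a) := by
          apply List.filter_congr
          intro x hx
          have hxa : x ≠ a := fun h => hal (h ▸ hx)
          simp [Finset.mem_erase, hxa]
        have IH := rank_table_sub_lprod_le ρ V hρ0 hρ hV l hl (S.erase a) hS'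
        rw [lprod_cons_of_mem V haS, List.filter_cons_of_pos (by simpa using haS), List.length_cons, hfilt]
        have hsplit : ρ S - V a * ((l.filter (· ∈ S.erase a)).map V).prod
            = (ρ S - ρ {a} * ρ (S.erase a)) + ((ρ {a} - V a) * ρ (S.erase a)
              + V a * (ρ (S.erase a) - ((l.filter (· ∈ S.erase a)).map V).prod)) := by
          noncomm_ring
        rw [hsplit]
        refine (rank_add_le _ _).trans ?_
        have h1 := hρ a S haS
        have h2 := (Matrix.rank_mul_le_left (ρ {a} - V a) (ρ (S.erase a))).trans (hV a)
        have h3 := (Matrix.rank_mul_le_right (V a)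
          (ρ (S.erase a) - ((l.filter (· ∈ S.erase a)).map V).prod)).trans IH
        have h4 := rank_add_le ((ρ {a} - V a) * ρ (S.erase a))
          (V a * (ρ (S.erase a) - ((l.filter (· ∈ S.erase a)).map V).prod))
        have : ((l.filter (· ∈ S.erase a)).length + 1) * (δ + c)
            = δ + (c + (l.filter (· ∈ S.erase a)).length * (δ + c)) := by ring
        rw [this]
        omega
      · have hS' : ∀ x ∈ S, x ∈ l := by
          intro x hx
          rcases List.mem_cons.mp (hS x hx) with h | h
          · exact absurd (h ▸ hx) haS
          · exact h
        rw [lprod_cons_of_not_mem V haS, List.filter_cons_of_neg (by simpa using haS)]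
        exact rank_table_sub_lprod_le ρ V hρ0 hρ hV l hl S hS'

end Tools

/-- **T1 (registered stub `stub_tableOfGenerator` of line `cell-union-merge`): generator-form polynomial
rank-stability of idempotents implies the table form N0b**, with output exponent `a + 2` (threshold `n ≥ 8`
beyond the hypothesis' own).  Proof: letters `U_i := ρ {i}`, almost idempotents `M_i := (1 - U_i)/2`,
exactification (`exists_idempotent_near`), the hypothesis at `t := 6δ`, commuting involutions
`U'_i := 1 - 2E'_i`, sorted products (`stub_sortingLemma` at `t = 0` gives exact multiplicativity), and the
peeling bookkeeping `rank_table_sub_lprod_le`. [folklore] -/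
theorem stub_tableOfGenerator :
    (∃ a : ℕ, ∀ᶠ n : ℕ in atTop, ∀ (K : Type) [Field K] [CharZero K] (d t : ℕ)
      (E : Fin n → Matrix (Fin d) (Fin d) K), (∀ i, E i * E i = E i) →
      (∀ i j, (E i * E j - E j * E i).rank ≤ t) →
      ∃ E' : Fin n → Matrix (Fin d) (Fin d) K, (∀ i, E' i * E' i = E' i) ∧ (∀ i j, E' i * E' j = E' j * E' i) ∧
        ∀ i, (E i - E' i).rank ≤ n ^ a * t) →
    ∃ a : ℕ, ∀ᶠ n : ℕ in atTop, ∀ (K : Type) [Field K] [CharZero K] (d δ : ℕ)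
      (ρ : Finset (Fin n) → Matrix (Fin d) (Fin d) K), ρ ∅ = 1 →
      (∀ S T : Finset (Fin n), (ρ S * ρ T - ρ (symmDiff S T)).rank ≤ δ) →
      ∃ π : Finset (Fin n) → Matrix (Fin d) (Fin d) K, π ∅ = 1 ∧
        (∀ S T : Finset (Fin n), π S * π T = π (symmDiff S T)) ∧
        ∀ S : Finset (Fin n), (ρ S - π S).rank ≤ n ^ a * δ := by
  rintro ⟨a, ha⟩
  refine ⟨a + 2, ?_⟩
  filter_upwards [ha, eventually_ge_atTop 8] with n hn hn8 K _ _ d δ ρ hρ0 hρ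
  classical
  have h2 : (2 : K) ≠ 0 := two_ne_zero
  -- Step 1: the letters `ρ {i}` are almost involutions that almost commute, and peel off the table
  have hUU : ∀ i : Fin n, (ρ {i} * ρ {i} - 1).rank ≤ δ := fun i => by
    have := hρ {i} {i}
    rwa [symmDiff_self, Finset.bot_eq_empty, hρ0] at this
  have hUc : ∀ i j : Fin n, (ρ {i} * ρ {j} - ρ {j} * ρ {i}).rank ≤ 2 * δ := fun i j => by
    have h1 := hρ {i} {j}
    have h1' := hρ {j} {i}
    rw [symmDiff_comm] at h1'
    have hsplit : ρ {i} * ρ {j} - ρ {j} * ρ {i}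
        = (ρ {i} * ρ {j} - ρ (symmDiff {i} {j})) - (ρ {j} * ρ {i} - ρ (symmDiff {i} {j})) := by abel
    rw [hsplit]
    have := rank_sub_le' (ρ {i} * ρ {j} - ρ (symmDiff {i} {j})) (ρ {j} * ρ {i} - ρ (symmDiff {i} {j}))
    omega
  have hpeel : ∀ (i : Fin n) (S : Finset (Fin n)), i ∈ S → (ρ S - ρ {i} * ρ (S.erase i)).rank ≤ δ := by
    intro i S hi
    have := hρ {i} (S.erase i)
    rw [symmDiff_singleton_erase hi] at this
    rw [← rank_neg_eq, neg_sub]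
    exact this
  -- Step 2: the almost idempotents `M i := (1 - ρ {i}) / 2`
  let M : Fin n → Matrix (Fin d) (Fin d) K := fun i => (2 : K)⁻¹ • (1 - ρ {i})
  have hMdef : ∀ i, M i = (2 : K)⁻¹ • (1 - ρ {i}) := fun i => rfl
  have hMsq : ∀ i, (M i * M i - M i).rank ≤ δ := fun i => by
    have h1 : M i * M i - M i = ((2 : K)⁻¹ * (2 : K)⁻¹) • (ρ {i} * ρ {i} - 1) := by
      rw [hMdef]
      simp only [smul_mul_smul_comm, sub_mul, mul_sub, one_mul, mul_one, smul_sub]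
      module
    rw [h1]
    exact (rank_smul_le _ _).trans (hUU i)
  have hMc : ∀ i j, (M i * M j - M j * M i).rank ≤ 2 * δ := fun i j => by
    have h1 : M i * M j - M j * M i = ((2 : K)⁻¹ * (2 : K)⁻¹) • (ρ {i} * ρ {j} - ρ {j} * ρ {i}) := by
      rw [hMdef, hMdef]
      simp only [smul_mul_smul_comm, sub_mul, mul_sub, one_mul, mul_one, smul_sub]
      module
    rw [h1]
    exact (rank_smul_le _ _).trans (hUc i j)
  -- Step 3: exactification
  choose E hE hEM using fun i => exists_idempotent_near (M i)
  have hs : ∀ i, (M i - E i).rank ≤ δ := fun i => (hEM i).trans (hMsq i)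
  have hs' : ∀ i, (E i - M i).rank ≤ δ := fun i => by
    rw [← rank_neg_eq]; simpa using hs i
  have hcE : ∀ i j, (E i * E j - E j * E i).rank ≤ 6 * δ := by
    intro i j
    have h1 : E i * E j - E j * E i
        = (M i * M j - M j * M i) + ((E i - M i) * E j + M i * (E j - M j))
          - ((E j - M j) * E i + M j * (E i - M i)) := by noncomm_ring
    rw [h1]
    have r0 := rank_sub_le' ((M i * M j - M j * M i) + ((E i - M i) * E j + M i * (E j - M j)))
      ((E j - M j) * E i + M j * (E i - M i))
    have r1 := rank_add_le (M i * M j - M j * M i) ((E i - M i) * E j + M i * (E j - M j))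
    have r2 := rank_add_le ((E i - M i) * E j) (M i * (E j - M j))
    have r3 := rank_add_le ((E j - M j) * E i) (M j * (E i - M i))
    have e1 := (Matrix.rank_mul_le_left (E i - M i) (E j)).trans (hs' i)
    have e2 := (Matrix.rank_mul_le_right (M i) (E j - M j)).trans (hs' j)
    have e3 := (Matrix.rank_mul_le_left (E j - M j) (E i)).trans (hs' j)
    have e4 := (Matrix.rank_mul_le_right (M j) (E i - M i)).trans (hs' i)
    have e0 := hMc i j
    omega
  -- Step 4: the hypothesis at `t := 6δ`
  obtain ⟨E', hE'i, hE'c, hE'd⟩ := hn K d (6 * δ) E hE hcE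
  -- Step 5: commuting involutions
  let U' : Fin n → Matrix (Fin d) (Fin d) K := fun i => 1 - (2 : K) • E' i
  have hU'def : ∀ i, U' i = 1 - (2 : K) • E' i := fun i => rfl
  have hU'sq : ∀ i, U' i * U' i = 1 := by
    intro i
    rw [hU'def]
    have h4 : ((2 : K) • E' i) * ((2 : K) • E' i) = (4 : K) • E' i := by
      rw [smul_mul_smul_comm, hE'i i]; norm_num
    simp only [sub_mul, mul_sub, one_mul, mul_one, h4]
    module
  have hU'comm : ∀ i j, U' i * U' j = U' j * U' i := by
    intro i j
    rw [hU'def, hU'def]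
    simp only [sub_mul, mul_sub, one_mul, mul_one, smul_mul_smul_comm, hE'c i j]
    abel
  have hU'c0 : ∀ i j, (U' i * U' j - U' j * U' i).rank ≤ 0 := by
    intro i j
    rw [hU'comm i j, sub_self, Matrix.rank_zero]
  -- Step 6: the genuine representation: sorted products of the `U' i`
  refine ⟨fun S => (((List.finRange n).filter (· ∈ S)).map U').prod, by simp, ?_, ?_⟩
  · intro S T
    have h := stub_sortingLemma K n d 0 U' hU'sq hU'c0 S T
    rw [Nat.mul_zero, Nat.le_zero] at h
    exact sub_eq_zero.mp (eq_zero_of_rank_eq_zero h)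
  · -- Step 7: distances, peeling the letters of `S` in increasing order
    intro S
    have hV : ∀ i, (ρ {i} - U' i).rank ≤ δ + n ^ a * (6 * δ) := by
      intro i
      have hVi : ρ {i} - U' i = (2 : K) • ((E' i - E i) + (E i - M i)) := by
        rw [hU'def, hMdef, smul_add, smul_sub, smul_sub, smul_smul, mul_inv_cancel₀ h2, one_smul]
        abel
      rw [hVi]
      refine (rank_smul_le _ _).trans ((rank_add_le _ _).trans ?_)
      have h1 : (E' i - E i).rank ≤ n ^ a * (6 * δ) := by
        rw [← rank_neg_eq, neg_sub]; exact hE'd i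
      have h2' := hs' i
      omega
    have hmain := rank_table_sub_lprod_le ρ U' hρ0 hpeel hV (List.finRange n) (List.nodup_finRange n) S
      (fun x _ => List.mem_finRange x)
    refine hmain.trans ?_
    have hlen : ((List.finRange n).filter (· ∈ S)).length ≤ n :=
      (List.length_filter_le _ _).trans (List.length_finRange (n := n)).le
    refine (Nat.mul_le_mul_right _ hlen).trans ?_
    -- `n · (2δ + 6 n^a δ) ≤ 8 n^{a+1} δ ≤ n^{a+2} δ` for `n ≥ 8`
    have hn1 : n ≤ n ^ (a + 1) := by
      calc n = n ^ 1 := (pow_one n).symm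
        _ ≤ n ^ (a + 1) := Nat.pow_le_pow_right (by omega) (by omega)
    have hre : n * (δ + (δ + n ^ a * (6 * δ))) = 2 * (n * δ) + 6 * (n ^ (a + 1) * δ) := by ring
    rw [hre]
    have h3 : n * δ ≤ n ^ (a + 1) * δ := Nat.mul_le_mul_right δ hn1
    calc 2 * (n * δ) + 6 * (n ^ (a + 1) * δ) ≤ 8 * (n ^ (a + 1) * δ) := by omega
      _ ≤ n * (n ^ (a + 1) * δ) := Nat.mul_le_mul_right _ hn8
      _ = n ^ (a + 2) * δ := by ring

end Summit.PneNP.PneNP.Theorems.CnfIdealGenLengthRankDefectRepresentationsTableOfGenerator
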